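import Summits.ValiantsHypothesis.ValiantsHypothesis.Theorems.BarrierLeverNaturalProofsAgainstAllLinearSizesOfCountSize
import Literature.Computability.AlgebraicComplexity.ABV17SingularLocusBound
import Literature.Computability.AlgebraicComplexity.PencilFamily
import Literature.Computability.AlgebraicComplexity.RazElusiveGeneralProofs
import Literature.RingTheory.KrullDimension.HomogeneousCommonZero
import Literature.RingTheory.MvPolynomial.HomogeneousDimension

/-!
# Route BarrierLever — an algebraic natural proof against determinantal complexity EQUAL TO THE
# DEGREE (crux `DefinableDcEquations`, stmt-ValiantsHypothesis-8746, at the threshold `m(n) = n`)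

The rank-4 crux `DefinableDcEquations` asks for boolean-sum (`VNP(N)`-explicit) equations vanishing
on the coefficient vectors of `{f ∈ ℂ[x₁..xₙ] : deg f ≤ n, dc f ≤ m(n)}` for a super-quasi-quadratic
threshold `m`.  Below the degree (`m(n) < n`) the equation clause is trivial (`deg f ≤ dc f`); this
file settles the FIRST NONTRIVIAL THRESHOLD `m(n) = n` — determinantal complexity equal to the degree
and to the number of variables — unconditionally and with a `VP(N)` (indeed `poly(n)`-size) witness:

* `exists_ne_zero_grad_det_eq_zero` — **every determinantal hypersurface in `≥ 5` homogeneous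
  variables is singular**: for an `m × m` matrix `A` (`m ≥ 2`) of linear forms in `N ≥ 5` variables
  over `ℂ` there is `ξ ≠ 0` with `det A(ξ) = 0` and `∇(det A)(ξ) = 0`.  This is Alper–Bogart–Velasco
  2017 Thm. 1.7 (second bullet), PROVED in the tree in height form
  (`alperBogartVelasco2017_thm_1_7_singular`: `height (det A, ∇ det A) ≤ 4 < N`, Eagon's bound for
  submaximal minors), turned into a point by "minimal primes of a homogeneous ideal are homogeneous"
  (`isHomogeneous_of_mem_minimalPrimes`), `height (x₁..x_N) = N` (`height_ker_constantCoeff`) and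
  the Nullstellensatz (`IsPrime.vanishingIdeal_zeroLocus`).
* `eval_certPoly_five_eq_zero_of_dc_le` — for `n ≥ 5` and every `f` with `deg f ≤ n`, `dc f ≤ n`:
  the cell's Macaulay certificate `certPoly n 5` (the determinant of the Macaulay matrix of
  `∇ (f(x₁,…,x₅,0,…,0))_n`, item 20156's distinguisher with `k = 5`) VANISHES at `coeff f`:
  `f = det M` with `M` affine `n × n`, so the top form of the restriction is `det` of an `n × n`
  matrix of linear forms in `5` variables (`homogeneousComponent_card_det_of_totalDegree_le_one`),
  singular by the previous bullet, and a nonzero common zero of the gradient kills the Macaulay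
  determinant (`Macaulay.det_macaulay_grad_eq_zero`).
* `certPoly_five_mem_distinguishers` (`∈ Distinguishers ℂ n 81`, crude level from the cell's
  `size_arith`; the witness has size `poly(n) = polylog(N)`), `isNaturalProof_certPoly_five`,
  `not_isSuccinctHittingSet_dc_le_self` (the `dc`-exponent `b = 1` slice of item stmt-18966
  `SuccinctHittingSetsForVBP` is NOT a hitting set for level-`81` distinguishers, all `n ≥ 5`), and
  `dcEquations_at_degree_threshold` — the equation clause of `DefinableDcEquations` for the
  threshold function `m(n) = n`, level `a = 81`, `q = 0` boolean variables.

Honest framing: the crux asks for `m(n) ≥ 2^(C log² n)`; here `m(n) = n` (the `dc` analogue of the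
`b ≤ 1` rung of `DefinableEquations` and of the linear-size natural proofs of item 20156).  Nothing
here bears on `VP` vs `VNP`.  No definitions, no named facts; standard axioms.

References: Alper–Bogart–Velasco, Found. Comput. Math. 17 (2017) Thm. 1.7 [AlperBogartVelasco2017];
Cox–Little–O'Shea, *Using Algebraic Geometry*, Ch. 3 §4 [CoxLittleOSheaUsing2005].
-/

-- layout Summits/ValiantsHypothesis/ValiantsHypothesis forces the duplicated namespace component
set_option linter.dupNamespace false

noncomputable section

open MvPolynomial Finset

namespace Summit.ValiantsHypothesis.ValiantsHypothesis.Theorems.BarrierLever.DcEqualsDegree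

open Literature.Computability.AlgebraicComplexity
open Literature.RingTheory.MvPolynomial.Macaulay
open Literature.Barriers.ValiantsHypothesis
open Summit.ValiantsHypothesis.ValiantsHypothesis.Theorems.BarrierLever.NaturalProofsAgainstAllLinearSizes

/-! ## §1 Determinantal hypersurfaces in at least five variables are singular (ABV Thm. 1.7) -/

/-- **Every determinantal hypersurface in `≥ 5` homogeneous variables is singular.**  For an
`m × m` matrix `A` of linear forms in `N ≥ 5` variables over `ℂ` (`m ≥ 2`) there is a NONZERO point
`ξ` at which `det A` and all its first partials vanish.  Height form = the tree's
`alperBogartVelasco2017_thm_1_7_singular` (`height (det A, ∂ᵢ det A) < N`); the passage to a point: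
the singular ideal is homogeneous, so a minimal prime of it realising the height is homogeneous
(`isHomogeneous_of_mem_minimalPrimes`), hence inside the irrelevant ideal `𝔪₀` of height `N`
(`height_ker_constantCoeff`) and different from it; by the Nullstellensatz its zero set is not
`{0}`. [cite: AlperBogartVelasco2017, Thm. 1.7] -/
theorem exists_ne_zero_grad_det_eq_zero {N m : ℕ} (hN : 4 < N) (hm : 2 ≤ m)
    (A : Matrix (Fin m) (Fin m) (MvPolynomial (Fin N) ℂ)) (hA : ∀ i j, (A i j).IsHomogeneous 1) :
    ∃ ξ : Fin N → ℂ, ξ ≠ 0 ∧ eval ξ A.det = 0 ∧ ∀ i, eval ξ (pderiv i A.det) = 0 := by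
  classical
  -- the standard grading of `MvPolynomial` by total degree (a local instance in Mathlib)
  letI : GradedAlgebra (homogeneousSubmodule (Fin N) ℂ) := MvPolynomial.gradedAlgebra
  set I : Ideal (MvPolynomial (Fin N) ℂ) := singIdeal A.det with hIdef
  -- height of the singular ideal is `< N`
  have hlt : I.height < N := by
    have h := alperBogartVelasco2017_thm_1_7_singular hm A hA (by simpa using hN)
    simpa [Fintype.card_fin] using h
  -- the singular ideal is homogeneous
  have hdet : A.det.IsHomogeneous m := by
    simpa [Fintype.card_fin] using AlperBogartVelasco.isHomogeneous_det_of_linear A hA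
  have hIhom : I.IsHomogeneous (homogeneousSubmodule (Fin N) ℂ) := by
    rw [hIdef, singIdeal]
    refine Ideal.homogeneous_span (𝒜 := homogeneousSubmodule (Fin N) ℂ) _ ?_
    intro x hx
    rcases hx with rfl | ⟨i, rfl⟩
    · exact ⟨m, (mem_homogeneousSubmodule m _).2 hdet⟩
    · exact ⟨m - 1, (mem_homogeneousSubmodule (m - 1) _).2 hdet.pderiv⟩
  -- a minimal prime of small height
  have hJ : ∃ J ∈ I.minimalPrimes, J.height < N := by
    by_contra hcon
    push Not at hcon
    have hge : (N : ℕ∞) ≤ I.height := by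
      rw [Ideal.height_eq_inf_minimalPrimes]
      exact le_iInf₂ hcon
    exact absurd hlt (not_lt.2 hge)
  obtain ⟨J, hJmin, hJlt⟩ := hJ
  haveI hJprime : J.IsPrime := hJmin.1.1
  set m₀ : Ideal (MvPolynomial (Fin N) ℂ) :=
    RingHom.ker (constantCoeff : MvPolynomial (Fin N) ℂ →+* ℂ) with hm₀
  have hJhom := Literature.RingTheory.MvPolynomial.isHomogeneous_of_mem_minimalPrimes hIhom hJmin
  have hJle : J ≤ m₀ :=
    Literature.RingTheory.MvPolynomial.le_ker_constantCoeff_of_isHomogeneous hJhom hJprime.ne_top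
  have hJne : J ≠ m₀ := by
    intro h
    rw [h, hm₀, Literature.RingTheory.KrullDimension.height_ker_constantCoeff] at hJlt
    exact lt_irrefl _ hJlt
  -- Nullstellensatz: the zero set of `J` is not `{0}`
  have hnot : ¬ (zeroLocus ℂ J ⊆ ({0} : Set (Fin N → ℂ))) := by
    intro hsub
    apply hJne (le_antisymm hJle ?_)
    have h1 : vanishingIdeal ℂ ({0} : Set (Fin N → ℂ)) ≤ vanishingIdeal ℂ (zeroLocus ℂ J) :=
      vanishingIdeal_anti_mono hsub
    rw [IsPrime.vanishingIdeal_zeroLocus] at h1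
    refine le_trans (fun p hp => ?_) h1
    rw [mem_vanishingIdeal_iff]
    intro x hx
    rw [Set.mem_singleton_iff.1 hx, aeval_zero, Algebra.algebraMap_self_apply]
    exact (RingHom.mem_ker).1 hp
  obtain ⟨ξ, hξJ, hξ0⟩ := Set.not_subset.1 hnot
  have hIJ : I ≤ J := hJmin.1.2
  have hvan : ∀ p ∈ I, eval ξ p = 0 := fun p hp => by
    have h := (mem_zeroLocus_iff.1 hξJ) p (hIJ hp)
    rwa [aeval_eq_eval] at h
  exact ⟨ξ, hξ0, hvan _ (self_mem_singIdeal _), fun i => hvan _ (pderiv_mem_singIdeal _ i)⟩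

/-! ## §2 The Macaulay certificate vanishes on `{deg f ≤ n, dc f ≤ n}` -/

/-- **The certificate vanishes on determinantal expressions of size equal to the degree.**  For
`n ≥ 5` and `f ∈ ℂ[x₁..xₙ]` with `deg f ≤ n` and `dc f ≤ n`, the Macaulay determinant `certPoly n 5`
of the gradient of the top form of `f(x₁,…,x₅,0,…,0)` vanishes at `coeff f`.  Proof: `f = det M`,
`M` an affine `n × n` matrix (`hasDetRepr_iff_determinantalComplexity_le`); restricting to the first
five coordinates keeps the entries affine, and the degree-`n` component of an `n × n` affine
determinant is the determinant of the linear parts (`homogeneousComponent_card_det_of_totalDegree_le_one`)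
— an `n × n` matrix of linear forms in `5` variables, whose determinant has a nonzero singular point
(`exists_ne_zero_grad_det_eq_zero`), which kills the Macaulay determinant of the gradient
(`Macaulay.det_macaulay_grad_eq_zero`, `eval_certPoly`). [cite: AlperBogartVelasco2017, Thm. 1.7] -/
theorem eval_certPoly_five_eq_zero_of_dc_le {n : ℕ} (hn : 5 ≤ n) (f : MvPolynomial (Fin n) ℂ)
    (hdeg : f.totalDegree ≤ n) (hdc : determinantalComplexity f ≤ n) :
    eval (coeffVector (degLEMonomials n) f) (certPoly n 5) = 0 := by
  classical
  obtain ⟨M, hM1, hMdet⟩ := (hasDetRepr_iff_determinantalComplexity_le_holds f n).2 hdc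
  -- restriction to the first five coordinates
  let ρ : MvPolynomial (Fin n) ℂ →ₐ[ℂ] MvPolynomial (Fin 5) ℂ := aeval (restr ℂ n 5)
  have hM'1 : ∀ i j, ((ρ.mapMatrix M) i j).totalDegree ≤ 1 := fun i j =>
    (totalDegree_aeval_restr_le (M i j)).trans (hM1 i j)
  have hdet' : (ρ.mapMatrix M).det = ρ f := by
    rw [← AlgHom.map_det, hMdet]
  -- the top form of the restriction is a determinant of linear forms
  have htop : homogeneousComponent n (ρ f) =
      ((ρ.mapMatrix M).map (homogeneousComponent 1)).det := by
    have h := homogeneousComponent_card_det_of_totalDegree_le_one (ρ.mapMatrix M) hM'1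
    rw [Fintype.card_fin, hdet'] at h
    exact h
  have hA : ∀ i j, (((ρ.mapMatrix M).map (homogeneousComponent 1)) i j).IsHomogeneous 1 :=
    fun i j => homogeneousComponent_isHomogeneous 1 _
  obtain ⟨ξ, hξ, -, hgrad⟩ :=
    exists_ne_zero_grad_det_eq_zero (by norm_num : 4 < 5) (by omega : 2 ≤ n) _ hA
  rw [eval_certPoly 5 f hdeg]
  refine det_macaulay_grad_eq_zero _ (homogeneousComponent_isHomogeneous n _) ξ hξ fun i => ?_
  show eval ξ (pderiv i (homogeneousComponent n (ρ f))) = 0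
  rw [htop]
  exact hgrad i

/-! ## §3 Packaging: a level-`81` distinguisher, the hitting-set reading, the crux's clause -/

/-- `R = #mons 5 (5(n-2)+1) = C(5(n-1), 4) ≤ n^10` for `n ≥ 5` (the size of the Macaulay matrix
of five forms of degree `n - 1` in five variables). [folklore] -/
theorem card_mons_five_le {n : ℕ} (hn : 5 ≤ n) :
    (mons 5 (critDeg 5 (n - 1))).card ≤ n ^ 10 := by
  rw [mons, Finset.card_finsuppAntidiag_nat_eq_choose, Finset.card_univ, Fintype.card_fin]
  obtain ⟨m, rfl⟩ : ∃ m, n = m + 2 := ⟨n - 2, by omega⟩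
  have hcd : critDeg 5 (m + 2 - 1) = 5 * m + 1 := by
    unfold critDeg
    omega
  rw [hcd, show 5 + (5 * m + 1) - 1 = 5 * m + 5 by omega,
    show 5 * m + 5 = (5 * m + 1) + 4 by omega, Nat.choose_symm_add]
  calc (5 * m + 1 + 4).choose 4 ≤ (5 * m + 1 + 4) ^ 4 := Nat.choose_le_pow _ _
    _ ≤ ((m + 2) * (m + 2)) ^ 4 := Nat.pow_le_pow_left (by nlinarith) _
    _ ≤ ((m + 2) * (m + 2)) ^ 5 := Nat.pow_le_pow_right (by positivity) (by omega)
    _ = (m + 2) ^ 10 := by rw [← pow_two, ← pow_mul]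

/-- The bookkeeping from `R ≤ B^10`, `N ≤ B`, `2 ≤ B` to the two size inequalities of
`certPoly_mem_distinguishers` with exponent `81 = 7·10 + 11` (as in the cell's `size_arith`).
[folklore] -/
theorem size_arith_ten {R N B : ℕ} (hB : 2 ≤ B) (hR : R ≤ B ^ 10) (hN : N ≤ B) :
    8 * (R + 1) ^ 7 + R ^ 2 * (2 * N) ≤ B ^ 81 ∧ R ≤ B ^ 81 := by
  have hP : 1 ≤ B ^ 10 := Nat.one_le_pow _ _ (by omega)
  have hB1 : 0 < B := by omega
  have h1 : 8 * (R + 1) ^ 7 ≤ B ^ 80 := by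
    calc 8 * (R + 1) ^ 7 ≤ 8 * (2 * B ^ 10) ^ 7 :=
          Nat.mul_le_mul_left _ (Nat.pow_le_pow_left (by omega) 7)
      _ = 2 ^ 10 * (B ^ 10) ^ 7 := by ring
      _ ≤ B ^ 10 * (B ^ 10) ^ 7 := Nat.mul_le_mul_right _ (Nat.pow_le_pow_left hB 10)
      _ = B ^ 80 := by ring
  have h2 : R ^ 2 * (2 * N) ≤ B ^ 80 := by
    calc R ^ 2 * (2 * N) ≤ (B ^ 10) ^ 2 * (B * B) :=
          Nat.mul_le_mul (Nat.pow_le_pow_left hR 2) (Nat.mul_le_mul hB hN)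
      _ = B ^ 22 := by ring
      _ ≤ B ^ 80 := Nat.pow_le_pow_right hB1 (by omega)
  refine ⟨?_, hR.trans (Nat.pow_le_pow_right hB1 (by omega))⟩
  calc 8 * (R + 1) ^ 7 + R ^ 2 * (2 * N) ≤ 2 * B ^ 80 := by omega
    _ ≤ B * B ^ 80 := Nat.mul_le_mul_right _ hB
    _ = B ^ 81 := by ring

/-- `2 ≤ C(2n, n)` and `n ≤ C(2n, n)` for `n ≥ 1` (via `2n = C(2n, 1) ≤ C(2n, n)`). [folklore] -/
theorem two_le_centralChoose_and_le {n : ℕ} (hn : 1 ≤ n) :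
    2 ≤ (2 * n).choose n ∧ n ≤ (2 * n).choose n := by
  have h : (2 * n).choose 1 ≤ (2 * n).choose n := by
    have := Nat.choose_le_middle 1 (2 * n)
    rwa [Nat.mul_div_right n two_pos] at this
  rw [Nat.choose_one_right] at h
  exact ⟨le_trans (by omega) h, le_trans (by omega) h⟩

/-- **The certificate is a legitimate distinguisher** (size and degree `≤ N^81`, `N = C(2n,n)`;
in fact size `poly(n)`): `R = #mons 5 (5(n-2)+1) ≤ n^10 ≤ N^10` (`card_mons_five_le`),
`#degLEMonomials n ≤ N`, and the bookkeeping `size_arith_ten`. [folklore] -/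
theorem certPoly_five_mem_distinguishers {n : ℕ} (hn : 5 ≤ n) :
    certPoly n 5 ∈ Distinguishers ℂ n 81 := by
  classical
  -- `N = #degLEMonomials n ≤ C(2n, n)` (slack-variable injection into the degree-`n` monomials in
  -- `n + 1` variables; this is the cell's `card_degLEMonomials_le_choose`, inlined)
  have hN : Fintype.card (degLEMonomials n) ≤ (2 * n).choose n := by
    let ext : degLEMonomials n → ((Finset.univ : Finset (Fin (n + 1))).finsuppAntidiag n) :=
      fun m => ⟨m.1.mapDomain Fin.castSucc + Finsupp.single (Fin.last n) (n - m.1.degree), by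
        rw [Finset.mem_finsuppAntidiag]
        refine ⟨?_, Finset.subset_univ _⟩
        have hm : m.1.degree ≤ n := m.2
        rw [← Finsupp.degree_eq_sum, map_add, Finsupp.degree_mapDomain, Finsupp.degree_single]
        omega⟩
    have hinj : Function.Injective ext := by
      intro m₁ m₂ h
      have h' := congrArg (fun x => (x.1 : Fin (n + 1) →₀ ℕ)) h
      simp only [ext] at h'
      apply Subtype.ext
      ext i
      have := congrArg (fun x : Fin (n + 1) →₀ ℕ => x (Fin.castSucc i)) h'
      simpa [Finsupp.mapDomain_apply (Fin.castSucc_injective _), Finsupp.single_apply,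
        (Fin.castSucc_lt_last i).ne'] using this
    calc Fintype.card (degLEMonomials n)
        ≤ Fintype.card ((Finset.univ : Finset (Fin (n + 1))).finsuppAntidiag n) :=
          Fintype.card_le_of_injective ext hinj
      _ = (2 * n).choose n := by
        rw [Fintype.card_coe, Finset.card_finsuppAntidiag_nat_eq_choose, Finset.card_univ,
          Fintype.card_fin]
        congr 1
        omega
  obtain ⟨hB, hnB⟩ := two_le_centralChoose_and_le (n := n) (by omega)
  have hR : (mons 5 (critDeg 5 (n - 1))).card ≤ (2 * n).choose n ^ 10 :=
    (card_mons_five_le hn).trans (Nat.pow_le_pow_left hnB 10)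
  obtain ⟨h1, h2⟩ := size_arith_ten hB hR hN
  exact certPoly_mem_distinguishers h1 h2

/-- **An algebraic natural proof against `dc = deg`** (FSV Def. 1): for every `n ≥ 5`,
`certPoly n 5` is a nonzero level-`81` distinguisher vanishing on the coefficient vectors of all
`f` with `deg f ≤ n` and `dc f ≤ n`. [cite: AlperBogartVelasco2017, Thm. 1.7] -/
theorem isNaturalProof_certPoly_five {n : ℕ} (hn : 5 ≤ n) :
    IsNaturalProof (degLEMonomials n)
      {f : MvPolynomial (Fin n) ℂ | f.totalDegree ≤ n ∧ determinantalComplexity f ≤ n}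
      (Distinguishers ℂ n 81) (certPoly n 5) :=
  ⟨certPoly_five_mem_distinguishers hn, certPoly_ne_zero (by omega) hn,
    fun f hf => eval_certPoly_five_eq_zero_of_dc_le hn f hf.1 hf.2⟩

/-- **Hitting-set reading** (the `b = 1` slice of item stmt-ValiantsHypothesis-18966
`SuccinctHittingSetsForVBP`, which asks `∀ a ∃ b`): for every `n ≥ 5` the degree-`≤ n` polynomials
of determinantal complexity `≤ n ^ 1` are NOT a succinct hitting set for `Distinguishers ℂ n 81` —
at level `81` the `dc`-exponent must exceed `1`. [cite: ForbesShpilkaVolk2018, Thm. 4] -/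
theorem not_isSuccinctHittingSet_dc_le_self {n : ℕ} (hn : 5 ≤ n) :
    ¬ IsSuccinctHittingSet (degLEMonomials n)
      {f : MvPolynomial (Fin n) ℂ | f.totalDegree ≤ n ∧ determinantalComplexity f ≤ n ^ 1}
      (Distinguishers ℂ n 81) := by
  rw [pow_one, ← exists_isNaturalProof_iff]
  exact ⟨certPoly n 5, isNaturalProof_certPoly_five hn⟩

/-- **The equation clause of the crux `DefinableDcEquations` at the threshold `m(n) = n`**
(inner statement of `BarrierLever.DefinableDcEquations` with the threshold function `m := id` in
place of a super-quasi-quadratic one): level `a = 81`, from `n₀ = 5`, with `q = 0` boolean variables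
and `H = certPoly n 5` (renamed into the empty sum of boolean variables, `boolSum H = certPoly n 5`).
The growth clause of the crux is NOT met by `m(n) = n`; this is the first nontrivial threshold
(`m(n) < n` is trivial by `deg f ≤ dc f`). [cite: AlperBogartVelasco2017, Thm. 1.7] -/
theorem dcEquations_at_degree_threshold :
    ∃ a n₀ : ℕ, ∀ n ≥ n₀, ∃ q : ℕ, q ≤ (Nat.choose (2 * n) n) ^ a ∧
      ∃ H : MvPolynomial (↥(degLEMonomials n) ⊕ Fin q) ℂ,
        complexity H ≤ (Nat.choose (2 * n) n) ^ a ∧ H.totalDegree ≤ (Nat.choose (2 * n) n) ^ a ∧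
        boolSum H ≠ 0 ∧
        ∀ f : MvPolynomial (Fin n) ℂ, f.totalDegree ≤ n → determinantalComplexity f ≤ n →
          eval (coeffVector (degLEMonomials n) f) (boolSum H) = 0 := by
  refine ⟨81, 5, fun n hn => ⟨0, Nat.zero_le _, rename Sum.inl (certPoly n 5), ?_, ?_, ?_, ?_⟩⟩
  · exact (complexity_rename_le_holds' _ _).trans (certPoly_five_mem_distinguishers hn).1
  · exact (totalDegree_rename_le _ _).trans (certPoly_five_mem_distinguishers hn).2
  · rw [boolSum_rename_inl_zero]
    exact certPoly_ne_zero (by omega) hn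
  · intro f hdeg hdc
    rw [boolSum_rename_inl_zero]
    exact eval_certPoly_five_eq_zero_of_dc_le hn f hdeg hdc

/-! ## §4 The results in the quantifier shapes of the items (appended) -/

/-- **The crux `DefinableDcEquations` with its growth clause replaced by `m(n) ≤ n`.**  For EVERY
threshold function `m` that eventually stays at or below the degree (`m n ≤ n` for `n ≥ n₁`), the
equation clause of `BarrierLever.DefinableDcEquations` holds: level `a = 81`, from
`n₀ = max n₁ 5`, `q = 0`, `H = certPoly n 5`.  (The crux itself asks for `m n ≥ 2^(C (log₂ n + 1)²)`
eventually for every `C`; this is the partial range `m ≤ id`.) [cite: AlperBogartVelasco2017, Thm. 1.7] -/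
theorem dcEquations_of_threshold_le_degree (m : ℕ → ℕ) {n₁ : ℕ} (hm : ∀ n, n₁ ≤ n → m n ≤ n) :
    ∃ a n₀ : ℕ, ∀ n ≥ n₀, ∃ q : ℕ, q ≤ (Nat.choose (2 * n) n) ^ a ∧
      ∃ H : MvPolynomial (↥(degLEMonomials n) ⊕ Fin q) ℂ,
        complexity H ≤ (Nat.choose (2 * n) n) ^ a ∧ H.totalDegree ≤ (Nat.choose (2 * n) n) ^ a ∧
        boolSum H ≠ 0 ∧
        ∀ f : MvPolynomial (Fin n) ℂ, f.totalDegree ≤ n → determinantalComplexity f ≤ m n →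
          eval (coeffVector (degLEMonomials n) f) (boolSum H) = 0 := by
  obtain ⟨a, n₀, h⟩ := dcEquations_at_degree_threshold
  refine ⟨a, max n₀ n₁, fun n hn => ?_⟩
  obtain ⟨q, hq, H, hHc, hHd, hne, hvan⟩ := h n ((le_max_left _ _).trans hn)
  exact ⟨q, hq, H, hHc, hHd, hne, fun f hdeg hdc =>
    hvan f hdeg (hdc.trans (hm n ((le_max_right _ _).trans hn)))⟩

/-- **In item stmt-ValiantsHypothesis-18966 `SuccinctHittingSetsForVBP` (`∀ a ∃ b n₀ ∀ n ≥ n₀`,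
the `dc ≤ n^b` slice hits `Distinguishers ℂ n a`) the witness exponent must satisfy `b ≥ 2` for
every level `a ≥ 81`:** the choice `b = 1` fails at every `n₀` (indeed at every single `n ≥ 5`,
`not_isSuccinctHittingSet_dc_le_self` and monotonicity of `Distinguishers ℂ n ·` in the level, cf.
`NaturalProofsSeparateVNP.distinguishers_mono`). A `dc`-axis analogue of the KRST no-go bands of
items 19093/19340. [cite: ForbesShpilkaVolk2018, Thm. 4] -/
theorem succinctHittingSetsForVBP_needs_two_le {a : ℕ} (ha : 81 ≤ a) (n₀ : ℕ) :
    ¬ ∀ n : ℕ, n₀ ≤ n → IsSuccinctHittingSet (degLEMonomials n)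
      {f : MvPolynomial (Fin n) ℂ | f.totalDegree ≤ n ∧ determinantalComplexity f ≤ n ^ 1}
      (Distinguishers ℂ n a) := by
  intro h
  have h5 : 5 ≤ max n₀ 5 := le_max_right _ _
  have hmono : Distinguishers ℂ (max n₀ 5) 81 ⊆ Distinguishers ℂ (max n₀ 5) a := by
    intro D hD
    have hN : (Nat.choose (2 * max n₀ 5) (max n₀ 5)) ^ 81 ≤ (Nat.choose (2 * max n₀ 5) (max n₀ 5)) ^ a :=
      Nat.pow_le_pow_right (Nat.choose_pos (by omega)) ha
    exact ⟨hD.1.trans hN, hD.2.trans hN⟩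
  exact not_isSuccinctHittingSet_dc_le_self h5 ((h (max n₀ 5) (le_max_left _ _)).mono le_rfl hmono)

end Summit.ValiantsHypothesis.ValiantsHypothesis.Theorems.BarrierLever.DcEqualsDegree

end
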